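import Summits.NavierStokesRegularity.NavierStokesRegularity.Theorems.LerayQuarterDissipationFiniteDissipationLiouvilleLinks
import Summits.NavierStokesRegularity.NavierStokesRegularity.Theorems.LerayQuarterDissipationFiniteDissipationLiouvilleOfGaldi
import Summits.NavierStokesRegularity.NavierStokesRegularity.Theorems.LerayQuarterDissipationDissipativeZoom
import Summits.NavierStokesRegularity.NavierStokesRegularity.Theorems.HodographBetchovEquivalence
import Summits.NavierStokesRegularity.NavierStokesRegularity.Theorems.AdaptedFrequencyFrequencyRigidityLiouvilleImpliesTypeI
import HarnessLib

/-!
# Route `LerayQuarterDissipation`: the residual `EnstrophyQuarterLaw` is a CONSEQUENCE of the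
# summit, and under any of the line's Liouville statements Clay (A) is EQUIVALENT to it

Theorems file (seat ns-lqd-p1 g2; `--supports` the shared residual crux `EnstrophyQuarterLaw`,
stmt-NavierStokesRegularity-1574). Navier–Stokes regularity is NOT proved by anything here; no
summit is. Every statement is an implication/equivalence between named statements of the tree.

* `enstrophyQuarterLaw_of_navierStokesRegularity` — **S ⇒ C for the residual**: Clay (A)
  (`NavierStokesRegularity`) implies `EnstrophyQuarterLaw` (EQL, stmt-1574) — by VACUITY: under (A)
  no classical Leray–Hopf solution from a rapidly decaying datum is maximal at a finite time
  (`noBlowup_of_navierStokesRegularity`, Tao 2011 Cor. 11.4 / Clay-class uniqueness, in tree). So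
  EQL is not stronger than the summit (the tribunal's BC2 `S→C` probe, which timed out at birth).
* `navierStokesRegularity_iff_enstrophyQuarterLaw_of_fdl` — **what the line buys**: if the crux
  `FiniteDissipationLiouville` holds, then `NavierStokesRegularity ↔ EnstrophyQuarterLaw` (`←` is
  the route's deciding theorem with the PROVED supports `RecordTimeTypeI`, `DissipativeZoom`).
* the same equivalence under each STRONGER named statement that implies FDL (edges landed in
  `…Links`, `…OfGaldi`, and the tree's `(L) ⇒ (L′)`):
  `…_of_rdl` (child stmt-22508), `…_of_parabolicGaldiLiouville` (stmt-0893),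
  `…_of_typeIAncientLiouville` (stmt-4050), `…_of_liouvilleConjectureNS` ((L), the canonical
  `@[conjecture]` leaf `LiouvilleConjectureNS`).

Reading: on this line the Millennium problem (A) and Leray's quarter-rate enstrophy law for
blow-ups become ONE statement as soon as any of FDL ⟸ RDL ⟸ 0893, 4050 ⟸ (L) is available.
-/

noncomputable section

-- the summit and its single sub-problem share the name (CONVENTIONS §1), as in every Theorems file
set_option linter.dupNamespace false

namespace Summit.NavierStokesRegularity.NavierStokesRegularity.Theorems.FiniteDissipationLiouville.SummitEdge

open MeasureTheory Set Filter
open Literature.Analysis Literature.Analysis.FluidPDE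

/-- **Clay (A) implies the enstrophy quarter law** (vacuously: under (A) there is no maximal smooth
Leray–Hopf solution from a rapidly decaying datum with finite lifespan). -/
theorem enstrophyQuarterLaw_of_navierStokesRegularity (hA : _root_.NavierStokesRegularity) :
    Theses.LerayQuarterDissipation.EnstrophyQuarterLaw := by
  intro ν T hν hT u p hmax hLH hdec
  exact absurd (HodographBetchov.noBlowup_of_navierStokesRegularity hA ν T hν hT u p hmax.1 hLH hdec)
    hmax.2

/-- **Under FDL, Clay (A) ⟺ EQL.** If the crux `FiniteDissipationLiouville` holds, then
`NavierStokesRegularity ↔ EnstrophyQuarterLaw`: `→` by vacuity, `←` by the route's deciding theorem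
(`Theses.LerayQuarterDissipation.closes`) with the PROVED supports `RecordTimeTypeI`
(`lerayQuarterDissipation_recordTimeTypeI_proof`) and `DissipativeZoom`
(`lerayQuarterDissipation_dissipativeZoom_proof`). -/
theorem navierStokesRegularity_iff_enstrophyQuarterLaw_of_fdl
    (hL : Theses.LerayQuarterDissipation.FiniteDissipationLiouville) :
    _root_.NavierStokesRegularity ↔ Theses.LerayQuarterDissipation.EnstrophyQuarterLaw :=
  ⟨enstrophyQuarterLaw_of_navierStokesRegularity, fun hQ =>
    Theses.LerayQuarterDissipation.closes hQ lerayQuarterDissipation_recordTimeTypeI_proof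
      lerayQuarterDissipation_dissipativeZoom_proof hL⟩

/-- **Under the child crux RDL (stmt-22508), Clay (A) ⟺ EQL** (RDL ⟺ FDL, `…Links`). -/
theorem navierStokesRegularity_iff_enstrophyQuarterLaw_of_rdl
    (hR : Theses.LerayQuarterDissipation.RecurrentDissipativeLiouville) :
    _root_.NavierStokesRegularity ↔ Theses.LerayQuarterDissipation.EnstrophyQuarterLaw :=
  navierStokesRegularity_iff_enstrophyQuarterLaw_of_fdl
    (Links.finiteDissipationLiouville_iff_recurrentDissipativeLiouville.2 hR)

/-- **Under Galdi's parabolic gate (stmt-0893), Clay (A) ⟺ EQL** (0893 ⇒ FDL, `…OfGaldi`). -/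
theorem navierStokesRegularity_iff_enstrophyQuarterLaw_of_parabolicGaldiLiouville
    (hG : Theses.GaldiLiouvilleGate.ParabolicGaldiLiouville) :
    _root_.NavierStokesRegularity ↔ Theses.LerayQuarterDissipation.EnstrophyQuarterLaw :=
  navierStokesRegularity_iff_enstrophyQuarterLaw_of_fdl
    (OfGaldi.finiteDissipationLiouville_of_parabolicGaldiLiouville hG)

/-- **Under (L′) = `TypeIAncientLiouville` (stmt-4050), Clay (A) ⟺ EQL** (4050 ⇒ FDL, `…Links`). -/
theorem navierStokesRegularity_iff_enstrophyQuarterLaw_of_typeIAncientLiouville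
    (hX : Theses.ExtremalTypeIConstant.TypeIAncientLiouville) :
    _root_.NavierStokesRegularity ↔ Theses.LerayQuarterDissipation.EnstrophyQuarterLaw :=
  navierStokesRegularity_iff_enstrophyQuarterLaw_of_fdl
    (Links.finiteDissipationLiouville_of_typeIAncientLiouville' hX)

/-- **Under the Liouville conjecture (L) (`LiouvilleConjectureNS`, stmt-0057), Clay (A) ⟺ EQL**
((L) ⇒ (L′), tree `typeIAncientLiouville_of_liouvilleConjectureNS`; then as above). -/
theorem navierStokesRegularity_iff_enstrophyQuarterLaw_of_liouvilleConjectureNS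
    (hLiou : _root_.Summit.NavierStokesRegularity.NavierStokesRegularity.LiouvilleConjectureNS) :
    _root_.NavierStokesRegularity ↔ Theses.LerayQuarterDissipation.EnstrophyQuarterLaw :=
  navierStokesRegularity_iff_enstrophyQuarterLaw_of_typeIAncientLiouville
    (FrequencyRigidity.TwoEndedPinning.typeIAncientLiouville_of_liouvilleConjectureNS hLiou)

end Summit.NavierStokesRegularity.NavierStokesRegularity.Theorems.FiniteDissipationLiouville.SummitEdge

end
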